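import Summits.AtomisticToContinuum.HydrodynamicLimit.Theses.AntiMazurCoboundaries
import Literature.MathematicalPhysics.KineticTheory.HardSphereEulerProofs
import Literature.MathematicalPhysics.KineticTheory.HardBallErgodicity
import Literature.Analysis.FluidPDE.EmpiricalCollisionMeasure
import Summits.AtomisticToContinuum.HydrodynamicLimit.Theorems.CorrectorPressureDecay.Negative.FastSectorSandwichCore

/-!
# Negative knowledge for `CorrectorPressureDecay` (stmt-AtomisticToContinuum-14135): the fast-sector sandwich

Refuter `refuter-drefute-stmt-AtomisticToContinuum-14135-g2-0` (drefute gen 2 of the registered line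
`Cruxes/CorrectorPressureDecay/Lines/kinetic-entropy-collision-budget.lean`), 2026-08-16. Work copy:
`Cruxes/CorrectorPressureDecay/DrefuteSandwich.lean`; prose: `Cruxes/CorrectorPressureDecay/DREFUTE-g2-FastSectorDominance.md`.

WHAT IS PROVED (sorry-free):

  `fastSectorDominance_of_discreteWindowPressureDecay :
      OneBodyEntropyBudget → DiscreteWindowPressureDecay → FastSectorDominance`

where `OneBodyEntropyBudget` (stub 2, TRUE) and `FastSectorDominance` (stub 5, the line's open XL stub) are the registered
stub statements of the line COPIED VERBATIM (same tokens, machine-diffed; the skeleton is not an importable module), and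
`DiscreteWindowPressureDecay` is the crux-frame statement "the discrete-window exponential moment `∫ exp(2·A_n) dG_N` of every
admissible fast observable of amplitude `≤ κ₂` is `≤ e^{η(N+1)}` for all windows `H ≥ H₁(φ,g,η)`, all `N ≥ N₀`, every flow and
all fine samplings `n ≥ n₀`" — the shared wall `KineticFluxLdDecay` (stmt-10967) in the discrete-sampling form in which stubs 1
and 6 of the line live (10967 ⇒ it on paper: Hölder + invariance make `L ↦ L·log∫e^{Ā_L}dG_N` subadditive, so `∃τ` upgrades to
`∀H ≥ max(τ, τκ/η)`; right-endpoint Riemann sums of the piecewise-continuous path `t ↦ F(Φ_t z)` converge on the good set and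
bounded convergence gives all `n ≥ n₀(N,Φ,H)`).

MECHANISM (no kinetic theory, no collision record, no fast/slow splitting):
* Part A (abstract, any probability space): for a bounded measurable potential `V`,
  `KL(μ.tilted V ‖ μ) = E_{tilt}[V] − log∫e^V ≤ log∫e^{2V} + 2·log∫e^{−V}` (`toReal_klDiv_tilted`, `toReal_klDiv_tilted_le`:
  Jensen under the tilt with `Y = 2V`, and `0 ≤ log∫e^{V} + log∫e^{−V}` by Jensen twice). The ENTROPY of the window optimiser
  is bounded by two window PRESSURES (of `2g` and of `−g`).
* Part B (one law on `𝕋³ × ℝ³`): `fastDev π ≤ condKL π` for every finite `π` (`fastDev_le_condKL`) — pointwise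
  `klFun r − (√r − 1)² = 2√r·klFun(√r) ≥ 0`, Tonelli, `klDiv = ∫ klFun(dπ/dref) dref`. The WHOLE Hellinger deviation (slow AND
  fast sector) is below the conditional entropy.
* Part C (crux frame): with stub 2, `(N+1)·fd(Π̄(Q)) ≤ (N+1)·condKL(Π̄(Q)) ≤ KL(Q‖G_N) ≤ η(N+1)`: the dominance inequality with
  `A = C = 0`.

CONSEQUENCE (logical position of the line's open stub; corrects its docstring "strictly stronger, by design: it is the
mechanism … its failure alone would not refute the crux"): with the skeleton's own sorry-free composition (stubs 1,2,3,6 + FSD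
⇒ X), the glue `PressureCertificateTransfer` (X ⇒ 10967) and 10967 ⇒ `DiscreteWindowPressureDecay` (paper, above), the open
stub is EQUIVALENT to the crux X and to the wall 10967 as `∃κ`-statements (`10967 ⇒ DWPD ⇒ FSD ⇒ X ⇒ 10967`). In particular
`¬FSD ⇒ ¬X`, and any fast-sector statement carrying an `η(N+1)` slack collapses to X; a statement with content beyond X must be a
RATE at fixed amplitude. The repaired signature `FastSectorDominanceRate` (the registered stub with the slack quantifier moved
AFTER the window: `∃H₁ ∀H ≥ H₁ ∀η > 0 ∃N₀ …`, all other tokens verbatim) escapes the sandwich (its `H₁` may not depend on `η`),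
carries the linear-response rate `(N+1)·fd ≤ C·K/H`, and still implies the registered stub by pure quantifier logic
(`fastSectorDominance_of_rate`). Nothing here asserts a Theses decl.
-/

noncomputable section

open MeasureTheory ProbabilityTheory InformationTheory Set Filter Topology
open scoped ENNReal

namespace Summit.AtomisticToContinuum.HydrodynamicLimit.Theorems.CorrectorPressureDecayNegative.FastSectorSandwich

open Literature.MathematicalPhysics.KineticTheory (T3 V3 hsDiameter localGibbsLaw)
open Literature.Analysis.FluidPDE (HardSphereFlow Config)

/-! ## Part C — crux frame: `OneBodyEntropyBudget → DiscreteWindowPressureDecay → FastSectorDominance` -/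

section Frame

/-- (skeleton, verbatim) Hard-sphere flows of `N + 1` spheres of reduced diameter `σ` on `𝕋³`. -/
abbrev Flow (σ : ℝ) (N : ℕ) : Type :=
  HardSphereFlow (Literature.Analysis.FluidPDE.Torus.geometry (Fin 3)) (hsDiameter σ N) (N + 1)

/-- (skeleton, verbatim) Phase space of `N + 1` spheres on `𝕋³`. -/
abbrev Phase (N : ℕ) : Type := Config (N + 1) (Fin 3) T3

/-- (skeleton, verbatim) The flow-invariant global Gibbs law `G_N`. -/
abbrev gibbs (σ a θ : ℝ) (u₀ : V3) (N : ℕ) (Φ : Flow σ N) : Measure (Phase N) :=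
  localGibbsLaw σ (fun _ => a) (fun _ => u₀) (fun _ => θ) N Φ

/-- (skeleton, verbatim) `ℓ_N = (N+1)^{-1/3}`. -/
abbrev scale (N : ℕ) : ℝ := ((N + 1 : ℕ) : ℝ) ^ (-(1 / 3 : ℝ))

/-- (skeleton, verbatim) Standardised velocity. -/
abbrev stdVel (θ : ℝ) (u₀ : V3) (w : V3) : V3 := (Real.sqrt θ)⁻¹ • (w - u₀)

/-- (skeleton, verbatim) The fast one-body observable `F`. -/
abbrev fluxObs (θ : ℝ) (u₀ : V3) (φ : T3 → ℝ) (g : V3 → ℝ) (N : ℕ) (z : Phase N) : ℝ :=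
  ∑ i, φ (z i).1 * g ((Real.sqrt θ)⁻¹ • ((z i).2 - u₀))

/-- (skeleton, verbatim) Discrete window average. -/
def discAvg {σ : ℝ} {N : ℕ} (Φ : Flow σ N) (F : Phase N → ℝ) (n : ℕ) (lag : ℝ) (z : Phase N) : ℝ :=
  (n : ℝ)⁻¹ * ∑ j : Fin n, F (Φ.flow ((((j : ℕ) : ℝ) + 1) * lag) z)

/-- (skeleton, verbatim) The window optimiser `Q = G_N.tilted(2A)`. -/
def optimiser (σ a θ : ℝ) (u₀ : V3) (N : ℕ) (Φ : Flow σ N) (φ : T3 → ℝ) (g : V3 → ℝ) (n : ℕ) (lag : ℝ) :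
    Measure (Phase N) :=
  (gibbs σ a θ u₀ N Φ).tilted (fun z => 2 * discAvg Φ (fluxObs θ u₀ φ g N) n lag z)

/-- (skeleton, verbatim) Position and standardised velocity of particle `i` at time `t`. -/
def oneBodyObs (θ : ℝ) (u₀ : V3) {σ : ℝ} {N : ℕ} (Φ : Flow σ N) (t : ℝ) (i : Fin (N + 1)) (z : Phase N) :
    T3 × V3 :=
  ((Φ.flow t z i).1, stdVel θ u₀ (Φ.flow t z i).2)

/-- (skeleton, verbatim) The symmetrised window-averaged one-body law `Π̄`. -/
def windowOneBodyLaw (θ : ℝ) (u₀ : V3) {σ : ℝ} {N : ℕ} (Φ : Flow σ N) (P : Measure (Phase N)) (n : ℕ)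
    (lag : ℝ) : Measure (T3 × V3) :=
  ((((N + 1 : ℕ) : ℝ≥0∞))⁻¹ * ((n : ℝ≥0∞))⁻¹) •
    ∑ i : Fin (N + 1), ∑ j : Fin n, P.map (oneBodyObs θ u₀ Φ ((((j : ℕ) : ℝ) + 1) * lag) i)

/-- (skeleton, verbatim) Statement of stub 2 — a COPY of a crux-skeleton stub statement used as a hypothesis below;
not a literature fact, not to be relocated. -/
def OneBodyEntropyBudget : Prop :=
  ∀ (σ a θ : ℝ) (u₀ : V3), 0 < σ → σ ≤ 1 / 2 → 0 < a → 0 < θ →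
    ∀ (N : ℕ) (Φ : Flow σ N) (n : ℕ) (lag : ℝ), 1 ≤ n →
      ∀ P : Measure (Phase N), IsProbabilityMeasure P →
        IsProbabilityMeasure (windowOneBodyLaw θ u₀ Φ P n lag) ∧
        ((N + 1 : ℕ) : ℝ≥0∞) * condKL (windowOneBodyLaw θ u₀ Φ P n lag) ≤ klDiv P (gibbs σ a θ u₀ N Φ)

/-- (skeleton, verbatim) Statement of stub 4 (antecedent of stub 5) — a COPY of a crux-skeleton stub statement; not a
literature fact. -/
def CollisionTransportIdentity : Prop :=
  ∀ (σ a θ : ℝ) (u₀ : V3), 0 < σ → σ ≤ 1 / 2 → 0 < a → 0 < θ →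
    ∀ (N : ℕ) (Φ : Flow σ N) (P : Measure (Phase N)), IsProbabilityMeasure P → P ≪ gibbs σ a θ u₀ N Φ →
      ∀ T : ℝ, 0 ≤ T →
        Integrable (fun z => Φ.collisionSum (Set.Ioc 0 T) (fun _ => (1 : ℝ)) z) P →
        ∀ (i : Fin (N + 1)) (ψ : ℝ → T3 × V3 → ℝ),
          Continuous (Function.uncurry ψ) → (∃ C : ℝ, ∀ t p, |ψ t p| ≤ C) →
          (∀ p, Differentiable ℝ (fun t => ψ t p)) →
          Continuous (Function.uncurry fun t p => deriv (fun s => ψ s p) t) →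
          (∃ C : ℝ, ∀ t p, |deriv (fun s => ψ s p) t| ≤ C) →
          (∫ z, ψ T ((z i).1, stdVel θ u₀ (Φ.flow T z i).2) ∂P) -
              ∫ z, ψ 0 ((z i).1, stdVel θ u₀ (Φ.flow 0 z i).2) ∂P =
            (∫ z, Φ.collisionSum (Set.Ioc 0 T)
                (fun c => if c.fst = i then
                    ψ c.time ((z i).1, stdVel θ u₀ c.postVel.1) - ψ c.time ((z i).1, stdVel θ u₀ c.preVel.1)
                  else 0) z ∂P) +
              ∫ z, (∫ t in (0 : ℝ)..T, deriv (fun s => ψ s ((z i).1, stdVel θ u₀ (Φ.flow t z i).2)) t) ∂P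

/-- (skeleton, verbatim) Statement of stub 5, `stub_fastSectorDominance` (OPEN; shown below to be implied by window
pressure decay) — a COPY of a crux-skeleton stub statement; not a literature fact. -/
def FastSectorDominance : Prop :=
  CollisionTransportIdentity →
  ∀ (a θ : ℝ) (u₀ : V3), 0 < a → 0 < θ → ∃ σ₀ : ℝ, 0 < σ₀ ∧ ∀ σ : ℝ, 0 < σ → σ < σ₀ →
    ∃ κ₁ : ℝ, 0 < κ₁ ∧ ∃ A : ℝ, 0 ≤ A ∧ ∃ C : ℝ, 0 ≤ C ∧
      ∀ (φ : T3 → ℝ) (g : V3 → ℝ), Continuous φ → Continuous g → (∀ x, |φ x| ≤ 1) → (∀ v, |g v| ≤ κ₁) →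
        (∀ (c₀ c₂ : ℝ) (b : V3),
          ∫ v, g v * (c₀ + inner ℝ b v + c₂ * ‖v‖ ^ 2) ∂(stdGaussian V3) = 0) →
        ∀ η : ℝ, 0 < η → ∃ H₁ : ℝ, 0 < H₁ ∧ ∀ H : ℝ, H₁ ≤ H →
          ∃ N₀ : ℕ, ∀ N : ℕ, N₀ ≤ N → ∀ Φ : Flow σ N, ∃ n : ℕ, 1 ≤ n ∧
            ((N : ℝ) + 1) *
                (fastDev (windowOneBodyLaw θ u₀ Φ
                  (optimiser σ a θ u₀ N Φ φ g n (H * scale N / n)) n (H * scale N / n))).toReal ≤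
              C * (klDiv (optimiser σ a θ u₀ N Φ φ g n (H * scale N / n)) (gibbs σ a θ u₀ N Φ)).toReal / H +
                A * (klDiv (optimiser σ a θ u₀ N Φ φ g n (H * scale N / n)) (gibbs σ a θ u₀ N Φ)).toReal ^ 2 /
                  ((N : ℝ) + 1) +
                η * ((N : ℝ) + 1)

/-- **The middle of the sandwich.** DISCRETE-WINDOW PRESSURE DECAY at amplitude `κ₂`: for all admissible `φ, g`
(`|g| ≤ κ₂`), every `η > 0`, all windows `H ≥ H₁(φ,g,η)`, all `N ≥ N₀`, every flow and all samplings `n ≥ n₀`,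
`∫ exp(2·A_n) dG_N ≤ e^{η(N+1)}` (`A_n` the discrete average over the sample times `k·Hℓ_N/n`, `k = 1..n`). This is the
shared wall `KineticFluxLdDecay` (stmt-10967) in discrete-sampling form: 10967 ⇒ it by Hölder-subadditivity of
`L ↦ L·log∫e^{Ā_L}dG_N` (upgrading `∃τ` to `∀H ≥ H₁ := max(τ, κτ/η)`) and convergence of right-endpoint Riemann sums
of the piecewise-continuous path `t ↦ F(Φ_t z)` on the good set (bounded convergence; `n₀ = n₀(N, Φ, H)`). -/
def DiscreteWindowPressureDecay : Prop :=
  ∀ (a θ : ℝ) (u₀ : V3), 0 < a → 0 < θ → ∃ σ₀ : ℝ, 0 < σ₀ ∧ ∀ σ : ℝ, 0 < σ → σ < σ₀ →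
    ∃ κ₂ : ℝ, 0 < κ₂ ∧
      ∀ (φ : T3 → ℝ) (g : V3 → ℝ), Continuous φ → Continuous g → (∀ x, |φ x| ≤ 1) → (∀ v, |g v| ≤ κ₂) →
        (∀ (c₀ c₂ : ℝ) (b : V3),
          ∫ v, g v * (c₀ + inner ℝ b v + c₂ * ‖v‖ ^ 2) ∂(stdGaussian V3) = 0) →
        ∀ η : ℝ, 0 < η → ∃ H₁ : ℝ, 0 < H₁ ∧ ∀ H : ℝ, H₁ ≤ H →
          ∃ N₀ : ℕ, ∀ N : ℕ, N₀ ≤ N → ∀ Φ : Flow σ N, ∃ n₀ : ℕ, 1 ≤ n₀ ∧ ∀ n : ℕ, n₀ ≤ n →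
            ∫ z, Real.exp (2 * discAvg Φ (fluxObs θ u₀ φ g N) n (H * scale N / n) z) ∂(gibbs σ a θ u₀ N Φ) ≤
              Real.exp (η * ((N : ℝ) + 1))

/-- Measurability of the crux's one-body observable (continuity; `Config` over the torus is a Borel space). [folklore] -/
theorem measurable_fluxObs {θ : ℝ} {u₀ : V3} {φ : T3 → ℝ} {g : V3 → ℝ} (hφ : Continuous φ)
    (hg : Continuous g) (N : ℕ) : Measurable (fluxObs θ u₀ φ g N) := by
  refine Continuous.measurable ?_
  unfold fluxObs
  fun_prop

/-- `|F| ≤ (N+1)κ`. [folklore] -/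
theorem abs_fluxObs_le {θ κ : ℝ} {u₀ : V3} {φ : T3 → ℝ} {g : V3 → ℝ} (hφ1 : ∀ x, |φ x| ≤ 1)
    (hgκ : ∀ v, |g v| ≤ κ) (N : ℕ) (z : Phase N) : |fluxObs θ u₀ φ g N z| ≤ (N + 1) * κ := by
  calc |fluxObs θ u₀ φ g N z|
      ≤ ∑ i, |φ (z i).1 * g ((Real.sqrt θ)⁻¹ • ((z i).2 - u₀))| := Finset.abs_sum_le_sum_abs _ _
    _ ≤ ∑ _i : Fin (N + 1), κ := by
        refine Finset.sum_le_sum fun i _ => ?_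
        rw [abs_mul]
        calc |φ (z i).1| * |g ((Real.sqrt θ)⁻¹ • ((z i).2 - u₀))|
            ≤ 1 * κ := mul_le_mul (hφ1 _) (hgκ _) (abs_nonneg _) zero_le_one
          _ = κ := one_mul κ
    _ = (N + 1) * κ := by simp

/-- The discrete window average of a measurable observable is measurable (each `Φ.flow t` is measurable). [folklore] -/
theorem measurable_discAvg {σ : ℝ} {N : ℕ} (Φ : Flow σ N) {F : Phase N → ℝ} (hF : Measurable F) (n : ℕ)
    (lag : ℝ) : Measurable (discAvg Φ F n lag) := by
  unfold discAvg
  refine Measurable.const_mul ?_ _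
  refine Finset.measurable_sum _ fun j _ => ?_
  exact hF.comp (Φ.measurable_flow _)

/-- The discrete window average inherits the sup bound of the observable. [folklore] -/
theorem abs_discAvg_le {σ : ℝ} {N : ℕ} (Φ : Flow σ N) {F : Phase N → ℝ} {B : ℝ} (hB : ∀ z, |F z| ≤ B)
    {n : ℕ} (hn : 1 ≤ n) (lag : ℝ) (z : Phase N) : |discAvg Φ F n lag z| ≤ B := by
  have hn0 : (n : ℝ) ≠ 0 := Nat.cast_ne_zero.2 (by omega)
  have hnpos : 0 < (n : ℝ) := by exact_mod_cast hn
  unfold discAvg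
  rw [abs_mul, abs_inv, Nat.abs_cast]
  calc (n : ℝ)⁻¹ * |∑ j : Fin n, F (Φ.flow ((((j : ℕ) : ℝ) + 1) * lag) z)|
      ≤ (n : ℝ)⁻¹ * ∑ _j : Fin n, B := by
        refine mul_le_mul_of_nonneg_left ?_ (inv_nonneg.2 hnpos.le)
        exact (Finset.abs_sum_le_sum_abs _ _).trans (Finset.sum_le_sum fun j _ => hB _)
    _ = B := by
        rw [Finset.sum_const, Finset.card_univ, Fintype.card_fin, nsmul_eq_mul, ← mul_assoc,
          inv_mul_cancel₀ hn0, one_mul]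

/-- Scaling the velocity test scales the observable. [folklore] -/
theorem fluxObs_const_mul (θ : ℝ) (u₀ : V3) (φ : T3 → ℝ) (g : V3 → ℝ) (c : ℝ) (N : ℕ) (z : Phase N) :
    fluxObs θ u₀ φ (fun v => c * g v) N z = c * fluxObs θ u₀ φ g N z := by
  simp only [fluxObs, Finset.mul_sum]
  exact Finset.sum_congr rfl fun i _ => by ring

/-- Scaling the velocity test scales the discrete window average. [folklore] -/
theorem discAvg_fluxObs_const_mul {σ : ℝ} {N : ℕ} (Φ : Flow σ N) (θ : ℝ) (u₀ : V3) (φ : T3 → ℝ) (g : V3 → ℝ)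
    (c : ℝ) (n : ℕ) (lag : ℝ) (z : Phase N) :
    discAvg Φ (fluxObs θ u₀ φ (fun v => c * g v) N) n lag z = c * discAvg Φ (fluxObs θ u₀ φ g N) n lag z := by
  simp only [discAvg, fluxObs_const_mul, ← Finset.mul_sum]
  ring

/-- Scaling the velocity test preserves the orthogonality clause. [folklore] -/
theorem orth_const_mul {g : V3 → ℝ}
    (horth : ∀ (c₀ c₂ : ℝ) (b : V3), ∫ v, g v * (c₀ + inner ℝ b v + c₂ * ‖v‖ ^ 2) ∂(stdGaussian V3) = 0)
    (c : ℝ) :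
    ∀ (c₀ c₂ : ℝ) (b : V3), ∫ v, (c * g v) * (c₀ + inner ℝ b v + c₂ * ‖v‖ ^ 2) ∂(stdGaussian V3) = 0 := by
  intro c₀ c₂ b
  have h : (fun v => (c * g v) * (c₀ + inner ℝ b v + c₂ * ‖v‖ ^ 2)) =
      fun v => c * (g v * (c₀ + inner ℝ b v + c₂ * ‖v‖ ^ 2)) := by
    funext v; ring
  rw [h, integral_const_mul, horth, mul_zero]

/-- **THE SANDWICH (upper slice).** Stub 2 and discrete-window pressure decay at amplitude `κ₂` imply
`stub_fastSectorDominance` at amplitude `κ₂/2` with `A = C = 0`: for the window optimiser `Q`,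
`(N+1)·fd(Π̄(Q)) ≤ (N+1)·condKL(Π̄(Q)) ≤ KL(Q‖G_N) ≤ log∫e^{4A_n}dG_N + 2log∫e^{−2A_n}dG_N ≤ η(N+1)` — Part B, stub 2,
Part A, and the hypothesis applied to the admissible observables `2g` and `−g`. No kinetic input is used. [folklore] -/
theorem fastSectorDominance_of_discreteWindowPressureDecay (h₂ : OneBodyEntropyBudget)
    (hP : DiscreteWindowPressureDecay) : FastSectorDominance := by
  intro _h₄ a θ u₀ ha hθ
  obtain ⟨σ₀, hσ₀, HP⟩ := hP a θ u₀ ha hθ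
  refine ⟨min σ₀ (1 / 2), lt_min hσ₀ (by norm_num), fun σ hσ hσlt => ?_⟩
  have hσ₀' : σ < σ₀ := lt_of_lt_of_le hσlt (min_le_left _ _)
  have hσhalf : σ ≤ 1 / 2 := (lt_of_lt_of_le hσlt (min_le_right _ _)).le
  obtain ⟨κ₂, hκ₂, Hφ⟩ := HP σ hσ hσ₀'
  refine ⟨κ₂ / 2, half_pos hκ₂, 0, le_rfl, 0, le_rfl, fun φ g hφ hg hφ1 hgκ horth η hη => ?_⟩
  -- the two auxiliary admissible observables `2g` and `−g`
  have hgPc : Continuous fun v => 2 * g v := continuous_const.mul hg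
  have hgMc : Continuous fun v => (-1) * g v := continuous_const.mul hg
  have hgPb : ∀ v, |2 * g v| ≤ κ₂ := fun v => by
    rw [abs_mul, abs_of_pos (by norm_num : (0 : ℝ) < 2)]
    linarith [hgκ v]
  have hgMb : ∀ v, |(-1) * g v| ≤ κ₂ := fun v => by
    rw [neg_one_mul, abs_neg]
    linarith [hgκ v, abs_nonneg (g v)]
  have hη3 : 0 < η / 3 := by positivity
  obtain ⟨HP, hHP, PP⟩ := Hφ φ (fun v => 2 * g v) hφ hgPc hφ1 hgPb (orth_const_mul horth 2) (η / 3) hη3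
  obtain ⟨HM, hHM, PM⟩ := Hφ φ (fun v => (-1) * g v) hφ hgMc hφ1 hgMb (orth_const_mul horth (-1)) (η / 3) hη3
  refine ⟨max HP HM, lt_max_of_lt_left hHP, fun H hH => ?_⟩
  obtain ⟨NP, QP⟩ := PP H ((le_max_left _ _).trans hH)
  obtain ⟨NM, QM⟩ := PM H ((le_max_right _ _).trans hH)
  refine ⟨max NP NM, fun N hN Φ => ?_⟩
  obtain ⟨nP, hnP, RP⟩ := QP N ((le_max_left _ _).trans hN) Φ
  obtain ⟨nM, hnM, RM⟩ := QM N ((le_max_right _ _).trans hN) Φ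
  have hn : 1 ≤ max nP nM := hnP.trans (le_max_left _ _)
  refine ⟨max nP nM, hn, ?_⟩
  have ZP := RP (max nP nM) (le_max_left _ _)
  have ZM := RM (max nP nM) (le_max_right _ _)
  -- frame objects
  set n : ℕ := max nP nM with hndef
  set lag : ℝ := H * scale N / n with hlagdef
  set G : Measure (Phase N) := gibbs σ a θ u₀ N Φ with hGdef
  haveI hGprob : IsProbabilityMeasure G :=
    Literature.MathematicalPhysics.KineticTheory.isProbabilityMeasure_localGibbsLaw
      continuous_const continuous_const continuous_const (fun _ => ha) (fun _ => hθ) hσhalf N Φ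
  set V : Phase N → ℝ := fun z => 2 * discAvg Φ (fluxObs θ u₀ φ g N) n lag z with hVdef
  have hFm : Measurable (fluxObs θ u₀ φ g N) := measurable_fluxObs hφ hg N
  have hVm : Measurable V := (measurable_discAvg Φ hFm n lag).const_mul 2
  have hFb : ∀ z, |fluxObs θ u₀ φ g N z| ≤ (N + 1) * (κ₂ / 2) := abs_fluxObs_le hφ1 hgκ N
  have hVb : ∀ z, |V z| ≤ 2 * ((N + 1) * (κ₂ / 2)) := fun z => by
    rw [hVdef, abs_mul, abs_of_pos (by norm_num : (0 : ℝ) < 2)]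
    exact mul_le_mul_of_nonneg_left (abs_discAvg_le Φ hFb hn lag z) (by norm_num)
  -- the two pressures control `2V` and `−V`
  have hP : ∀ z, 2 * discAvg Φ (fluxObs θ u₀ φ (fun v => 2 * g v) N) n lag z = 2 * V z := fun z => by
    rw [discAvg_fluxObs_const_mul, hVdef]
  have hM : ∀ z, 2 * discAvg Φ (fluxObs θ u₀ φ (fun v => (-1) * g v) N) n lag z = -V z := fun z => by
    rw [discAvg_fluxObs_const_mul, hVdef]; ring
  simp_rw [hP] at ZP
  simp_rw [hM] at ZM
  have h2Vb : ∀ z, |2 * V z| ≤ 2 * (2 * ((N + 1) * (κ₂ / 2))) := fun z => by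
    rw [abs_mul, abs_of_pos (by norm_num : (0 : ℝ) < 2)]
    exact mul_le_mul_of_nonneg_left (hVb z) (by norm_num)
  have hnVb : ∀ z, |(-V z)| ≤ 2 * ((N + 1) * (κ₂ / 2)) := fun z => by rw [abs_neg]; exact hVb z
  have hVnm : Measurable fun z => -V z := hVm.neg
  have hIP : 0 < ∫ z, Real.exp (2 * V z) ∂G := integral_exp_pos (integrable_exp_of_abs_le (hVm.const_mul 2) h2Vb)
  have hIM : 0 < ∫ z, Real.exp (-V z) ∂G := integral_exp_pos (integrable_exp_of_abs_le hVnm hnVb)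
  have lP : Real.log (∫ z, Real.exp (2 * V z) ∂G) ≤ η / 3 * ((N : ℝ) + 1) := (Real.log_le_iff_le_exp hIP).2 ZP
  have lM : Real.log (∫ z, Real.exp (-V z) ∂G) ≤ η / 3 * ((N : ℝ) + 1) := (Real.log_le_iff_le_exp hIM).2 ZM
  -- entropy of the optimiser
  have hQ : optimiser σ a θ u₀ N Φ φ g n lag = G.tilted V := rfl
  have hK : (klDiv (G.tilted V) G).toReal ≤ η * ((N : ℝ) + 1) := by
    have := toReal_klDiv_tilted_le (μ := G) hVm hVb
    linarith
  have hKfin : klDiv (G.tilted V) G ≠ ∞ := klDiv_tilted_ne_top hVm hVb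
  -- one-body law of the optimiser: Part B + stub 2
  have hQprob : IsProbabilityMeasure (G.tilted V) := isProbabilityMeasure_tilted (integrable_exp_of_abs_le hVm hVb)
  obtain ⟨hLawprob, hbudget⟩ := h₂ σ a θ u₀ hσ hσhalf ha hθ N Φ n lag hn (G.tilted V) hQprob
  haveI := hLawprob
  set Law := windowOneBodyLaw θ u₀ Φ (G.tilted V) n lag with hLawdef
  have hchain : ((N + 1 : ℕ) : ℝ≥0∞) * fastDev Law ≤ klDiv (G.tilted V) G :=
    (mul_le_mul' le_rfl (fastDev_le_condKL Law)).trans hbudget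
  have hreal : ((N : ℝ) + 1) * (fastDev Law).toReal ≤ (klDiv (G.tilted V) G).toReal := by
    have h1 := ENNReal.toReal_mono hKfin hchain
    rw [ENNReal.toReal_mul] at h1
    have h2 : (((N + 1 : ℕ) : ℝ≥0∞)).toReal = (N : ℝ) + 1 := by
      rw [ENNReal.toReal_natCast, Nat.cast_add, Nat.cast_one]
    rw [h2] at h1
    exact h1
  rw [hQ]
  have hfin : ((N : ℝ) + 1) * (fastDev Law).toReal ≤ η * ((N : ℝ) + 1) := hreal.trans hK
  simpa using hfin


/-- **Suggested repair of the open stub (drefute g2).** `FastSectorDominance` with the slack quantifier moved AFTER the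
window: `∃ H₁ ∀ H ≥ H₁ ∀ η > 0 ∃ N₀ …` instead of `∀ η > 0 ∃ H₁ ∀ H ≥ H₁ ∃ N₀ …` (all other tokens verbatim). The `η(N+1)`
slack then only absorbs `N → ∞` corrections at FIXED `H` (transport `O(ℓ_N∇φ)`), and the content of the statement is the
RATE `(N+1)·fd ≤ C·K/H (+ A·K²/(N+1))` at fixed amplitude — the linear-response prediction `fd ≍ κ²t_rel²/(Hℓ_N)²`,
`k ≍ κ²t_rel/(Hℓ_N)`, `C ≍ (λσ²√θ)⁻¹` —, which is NOT a consequence of the crux (the sandwich needs `H ≥ H₁(η)`), while it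
still implies the registered stub (`fastSectorDominance_of_rate`) and hence the crux through the skeleton's composition. -/
def FastSectorDominanceRate : Prop :=
  CollisionTransportIdentity →
  ∀ (a θ : ℝ) (u₀ : V3), 0 < a → 0 < θ → ∃ σ₀ : ℝ, 0 < σ₀ ∧ ∀ σ : ℝ, 0 < σ → σ < σ₀ →
    ∃ κ₁ : ℝ, 0 < κ₁ ∧ ∃ A : ℝ, 0 ≤ A ∧ ∃ C : ℝ, 0 ≤ C ∧
      ∀ (φ : T3 → ℝ) (g : V3 → ℝ), Continuous φ → Continuous g → (∀ x, |φ x| ≤ 1) → (∀ v, |g v| ≤ κ₁) →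
        (∀ (c₀ c₂ : ℝ) (b : V3),
          ∫ v, g v * (c₀ + inner ℝ b v + c₂ * ‖v‖ ^ 2) ∂(stdGaussian V3) = 0) →
        ∃ H₁ : ℝ, 0 < H₁ ∧ ∀ H : ℝ, H₁ ≤ H → ∀ η : ℝ, 0 < η →
          ∃ N₀ : ℕ, ∀ N : ℕ, N₀ ≤ N → ∀ Φ : Flow σ N, ∃ n : ℕ, 1 ≤ n ∧
            ((N : ℝ) + 1) *
                (fastDev (windowOneBodyLaw θ u₀ Φ
                  (optimiser σ a θ u₀ N Φ φ g n (H * scale N / n)) n (H * scale N / n))).toReal ≤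
              C * (klDiv (optimiser σ a θ u₀ N Φ φ g n (H * scale N / n)) (gibbs σ a θ u₀ N Φ)).toReal / H +
                A * (klDiv (optimiser σ a θ u₀ N Φ φ g n (H * scale N / n)) (gibbs σ a θ u₀ N Φ)).toReal ^ 2 /
                  ((N : ℝ) + 1) +
                η * ((N : ℝ) + 1)

/-- The repaired (rate) form implies the registered stub: pure quantifier logic (`H₁` independent of `η`). -/
theorem fastSectorDominance_of_rate (h : FastSectorDominanceRate) : FastSectorDominance := by
  intro h₄ a θ u₀ ha hθ
  obtain ⟨σ₀, hσ₀, Hσ⟩ := h h₄ a θ u₀ ha hθ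
  refine ⟨σ₀, hσ₀, fun σ hσ hσlt => ?_⟩
  obtain ⟨κ₁, hκ₁, A, hA, C, hC, Hφ⟩ := Hσ σ hσ hσlt
  refine ⟨κ₁, hκ₁, A, hA, C, hC, fun φ g hφ hg hφ1 hgκ horth η hη => ?_⟩
  obtain ⟨H₁, hH₁, HH⟩ := Hφ φ g hφ hg hφ1 hgκ horth
  exact ⟨H₁, hH₁, fun H hH => HH H hH η hη⟩

end Frame

end Summit.AtomisticToContinuum.HydrodynamicLimit.Theorems.CorrectorPressureDecayNegative.FastSectorSandwich

end
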